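import Summits.AtomisticToContinuum.HydrodynamicLimit.Theorems.CollisionIsometryCLTCollisionalTransferLocalityDefs
import Summits.AtomisticToContinuum.HydrodynamicLimit.Theorems.CollisionIsometryCLTCollisionalTransferLocalityDefsB
import Summits.AtomisticToContinuum.HydrodynamicLimit.Theorems.CollisionIsometryCLTCollisionalTransferLocalityDefsC
import Summits.AtomisticToContinuum.HydrodynamicLimit.Theorems.CollisionIsometryCLTCollisionalTransferLocalityChannelAdditivity
import HarnessLib

/-!
# Vocabulary of the line `hemisphere-affine-slaving`, part D: the two ENGINE STATEMENTS of the crux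
(crux `CollisionalTransferLocality`, stmt-AtomisticToContinuum-9518; rank 3 of route `StiffCollisionalRelaxation`, rank 4 of
`CollisionIsometryCLT` — the two route decls are `rfl`-equal)

Definitions-only support file (`--supports stmt-AtomisticToContinuum-9518`) of the line lead (gen 1, seat c9), continuing
`…CollisionalTransferLocalityDefs` (p77328), `…DefsB`, `…DefsC`. After ten lead seats the line closes the crux BY NAME from route items
modulo exactly TWO research statements, one per channel of the `(ψ, χ)`-linear crux (skeleton v17.2,
`Cruxes/CollisionalTransferLocality/Lines/hemisphere_affine_slaving.lean`; the channel split itself is landed: `stub_channelAdditivity`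
p139073, `conclusion_of_channels` p139580). This file makes those two statements importable TREE vocabulary, in two forms each:

* `CollisionalStressLaw` — THE MESOSCALE COLLISIONAL-STRESS LAW (momentum channel; = the registered stub `stub_collisionalStressLaw`
  verbatim, line vocabulary): for all nice profiles `∃ σ₀ ∃ η₁ ∀ σ < σ₀ ∀ Φ ∀ t > 0`, [V] `VirialBounded` → ∀ admissible kernels,
  `DiluteAt … η₁` → ∀ smooth vector tests `ψ`: uniformly in `τ ≤ t`, in local-Gibbs probability, `Mfun σ Φ ψ 0 − (Rhs + Kfun)(ψ, 0) → 0` —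
  the flux-form sum of the even rank-2 mark `‖Δv_i‖ ω⊗ω:∇ψ` equals `∫∫ [div ψ + (2/5)D̄:∇ψ/(ρ̄θ̄)] p_c(ρ̄, θ̄)`: the collisional stress is
  isotropic and the local thermodynamic function `p_c` of the block fields;
* `CollisionalEnergyFluxLaw` — THE MESOSCALE COLLISIONAL-ENERGY-FLUX LAW (energy channel; = `stub_collisionalEnergyFluxLaw` verbatim): same
  prefix, ∀ smooth scalar tests `χ`: `Mfun σ Φ 0 χ − (Rhs + Kfun)(0, χ) → 0` — the cubic mark `‖Δv_i‖(V·ω)(ω·∇χ)`; energy flux `p_c ū`,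
  no collisional heat flux at leading order;
* `CollisionalStressLawInline`, `CollisionalEnergyFluxLawInline` — the SAME statements written in ROUTE vocabulary only (Mathlib /
  Literature names and `let`-telescopes, exactly as route decls are typed), so that a planner can file them verbatim as items; and the
  bookkeeping theorems `collisionalStressLaw_iff_inline`, `collisionalEnergyFluxLaw_iff_inline` (definitional unfolding + `∇0 = 0`,
  `div 0 = 0`) certifying that the inline texts ARE the line statements.
Nothing in this file is asserted: every `def … : Prop` is a statement the crux's compositions consume (research-level: the
Boltzmann–Enskog marked Campbell law along the non-equilibrium hard-sphere flow at fixed reduced density; no print —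
`Literature.Barriers.AtomisticToContinuum.BoltzmannHypothesisBarrierNarrow`; their equilibrium rungs are theorems of the tree).
-/

namespace Summit.AtomisticToContinuum.HydrodynamicLimit.Theorems.HemisphereAffineSlaving

open scoped BigOperators Topology Classical ENNReal InnerProductSpace
open Filter Set Function MeasureTheory

noncomputable section

open Literature.MathematicalPhysics.KineticTheory (T3 V3)

/-! ## The two engine statements (line vocabulary) -/

/-- **[Kσ] THE MESOSCALE COLLISIONAL-STRESS LAW** (momentum channel of the crux; = registered stub `stub_collisionalStressLaw` of the
skeleton, verbatim). See the module docstring. DEFINED here, never assumed. -/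
def CollisionalStressLaw : Prop :=
  ∀ (a₀ θ₀ : T3 → ℝ) (u₀ : T3 → V3), NiceProfiles a₀ θ₀ u₀ → ∃ σ₀ : ℝ, 0 < σ₀ ∧ ∃ η₁ : ℝ, 0 < η₁ ∧ ∀ σ : ℝ, 0 < σ → σ < σ₀ → ∀ (Φ : Flows σ) (t : ℝ), 0 < t → VirialBounded σ a₀ θ₀ u₀ Φ t → ∀ (γ C : ℝ) (φ : ℕ → T3 → ℝ), 0 < γ → γ ≤ 1 / 15 → AdmissibleKernel γ C φ → DiluteAt σ a₀ θ₀ u₀ Φ t φ η₁ → ∀ (ψ : ℝ → T3 → V3), Literature.Analysis.FunctionSpaces.Torus.IsSmoothSpaceTimeOn (Icc 0 t) ψ → ∀ δ : ℝ, 0 < δ → Tendsto (fun N : ℕ => Literature.MathematicalPhysics.KineticTheory.localGibbsLaw σ a₀ u₀ θ₀ N (Φ N) {z | ∃ τ ∈ Icc 0 t, δ < |Mfun σ Φ ψ (fun (_ : ℝ) (_ : T3) => (0 : ℝ)) N z τ - (Rhs σ Φ φ ψ (fun (_ : ℝ) (_ : T3) => (0 : ℝ)) N z τ + Kfun σ Φ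 φ ψ (fun (_ : ℝ) (_ : T3) => (0 : ℝ)) N z τ)|}) atTop (𝓝 0)

/-- **[Kq] THE MESOSCALE COLLISIONAL-ENERGY-FLUX LAW** (energy channel of the crux; = registered stub `stub_collisionalEnergyFluxLaw`,
verbatim). See the module docstring. DEFINED here, never assumed. -/
def CollisionalEnergyFluxLaw : Prop :=
  ∀ (a₀ θ₀ : T3 → ℝ) (u₀ : T3 → V3), NiceProfiles a₀ θ₀ u₀ → ∃ σ₀ : ℝ, 0 < σ₀ ∧ ∃ η₁ : ℝ, 0 < η₁ ∧ ∀ σ : ℝ, 0 < σ → σ < σ₀ → ∀ (Φ : Flows σ) (t : ℝ), 0 < t → VirialBounded σ a₀ θ₀ u₀ Φ t → ∀ (γ C : ℝ) (φ : ℕ → T3 → ℝ), 0 < γ → γ ≤ 1 / 15 → AdmissibleKernel γ C φ → DiluteAt σ a₀ θ₀ u₀ Φ t φ η₁ → ∀ (χ : ℝ → T3 → ℝ), Literature.Analysis.FunctionSpaces.Torus.IsSmoothSpaceTimeOn (Icc 0 t) χ → ∀ δ : ℝ, 0 < δ → Tendsto (fun N : ℕ => Literature.MathematicalPhysics.KineticTheory.localGibbsLaw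 σ a₀ u₀ θ₀ N (Φ N) {z | ∃ τ ∈ Icc 0 t, δ < |Mfun σ Φ (fun (_ : ℝ) (_ : T3) => (0 : V3)) χ N z τ - (Rhs σ Φ φ (fun (_ : ℝ) (_ : T3) => (0 : V3)) χ N z τ + Kfun σ Φ φ (fun (_ : ℝ) (_ : T3) => (0 : V3)) χ N z τ)|}) atTop (𝓝 0)

/-! ## The same two statements in route vocabulary (verbatim-fileable item texts) -/

/-- [Kσ] in ROUTE vocabulary (only `Mathlib`/`Literature` names and `let`-telescopes): the text a planner files as the shared engine item
`MesoscaleCollisionalStressLaw`. Equivalent to `CollisionalStressLaw` (`collisionalStressLaw_iff_inline`). -/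
def CollisionalStressLawInline : Prop :=
  ∀ (a₀ θ₀ : (UnitAddTorus (Fin 3)) → ℝ) (u₀ : (UnitAddTorus (Fin 3)) → (EuclideanSpace ℝ (Fin 3))), Continuous a₀ → Continuous θ₀ → Continuous u₀ → (∀ x, 0 < a₀ x) → (∀ x, 0 < θ₀ x) → ∃ σ₀ : ℝ, 0 < σ₀ ∧ ∃ η₁ : ℝ, 0 < η₁ ∧ ∀ σ : ℝ, 0 < σ → σ < σ₀ → ∀ Φ : (N : ℕ) → Literature.Analysis.FluidPDE.HardSphereFlow (Literature.Analysis.FluidPDE.Torus.geometry (Fin 3)) (Literature.MathematicalPhysics.KineticTheory.hsDiameter σ N) (N + 1), ∀ t : ℝ, 0 < t → let dv := fun (N : ℕ) (w : Literature.Analysis.FluidPDE.Config (N + 1) (Fin 3) (UnitAddTorus (Fin 3))) (i j : Fin (N + 1)) => (w i).2 - (Literature.Analysis.FluidPDE.reflectVel ((Literature.Analysis.FluidPDE.Torus.geometry (Fin 3)).sepVec (w i).1 (w j).1) ((w i).2, (w j).2)).1; let V := fun (N : ℕ) (z : Literature.Analysis.FluidPDE.Config (N + 1) (Fin 3) (UnitAddTorus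 (Fin 3))) (τ : ℝ) => ((N : ℝ) + 1)⁻¹ * (Φ N).collisionPairSum (Ioc 0 τ) (fun (_ : ℝ) (w : Literature.Analysis.FluidPDE.Config (N + 1) (Fin 3) (UnitAddTorus (Fin 3))) (i j : Fin (N + 1)) => Literature.MathematicalPhysics.KineticTheory.hsDiameter σ N * ‖dv N w i j‖ * (1 + ‖(w i).2‖ + ‖(w j).2‖)) z; (∀ δ : ℝ, 0 < δ → ∃ K : ℝ, ∀ᶠ N : ℕ in atTop, Literature.MathematicalPhysics.KineticTheory.localGibbsLaw σ a₀ u₀ θ₀ N (Φ N) {z | K < V N z t} ≤ ENNReal.ofReal δ) → ∀ (γ C : ℝ) (φ : ℕ → (UnitAddTorus (Fin 3)) → ℝ), 0 < γ → γ ≤ 1 / 15 → ((∀ N, Literature.Analysis.FunctionSpaces.Torus.IsSmooth (φ N)) ∧ (∀ N y, 0 ≤ φ N y) ∧ (∀ N, ∫ y, φ N y = 1) ∧ (∀ (N : ℕ) y, ((N : ℝ) + 1) ^ (-γ) ≤ Literature.Analysis.FluidPDE.Torus.euclidDist y 0 → φ N y = 0) ∧ (∀ (N : ℕ) y, φ N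 y ≤ C * ((N : ℝ) + 1) ^ (3 * γ)) ∧ (∀ (N : ℕ) y, ‖Literature.Analysis.FunctionSpaces.Torus.gradient (φ N) y‖ ≤ C * ((N : ℝ) + 1) ^ (4 * γ))) → let ρb := fun (N : ℕ) (z : Literature.Analysis.FluidPDE.Config (N + 1) (Fin 3) (UnitAddTorus (Fin 3))) (x : (UnitAddTorus (Fin 3))) => Literature.MathematicalPhysics.KineticTheory.empiricalDensityField z (fun y => φ N (y - x)); let mb := fun (N : ℕ) (z : Literature.Analysis.FluidPDE.Config (N + 1) (Fin 3) (UnitAddTorus (Fin 3))) (x : (UnitAddTorus (Fin 3))) => Literature.MathematicalPhysics.KineticTheory.empiricalMomentumField z (fun y => φ N (y - x)); let Eb := fun (N : ℕ) (z : Literature.Analysis.FluidPDE.Config (N + 1) (Fin 3) (UnitAddTorus (Fin 3))) (x : (UnitAddTorus (Fin 3))) => Literature.MathematicalPhysics.KineticTheory.empiricalEnergyField z (fun y => φ N (y - x)); let ub := fun (N : ℕ) (z : Literature.Analysis.FluidPDE.Config (N + 1) (Fin 3) (UnitAddTorus (Fin 3))) (x : (UnitAddTorus (Fin 3))) => (ρb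 N z x)⁻¹ • mb N z x; let θb := fun (N : ℕ) (z : Literature.Analysis.FluidPDE.Config (N + 1) (Fin 3) (UnitAddTorus (Fin 3))) (x : (UnitAddTorus (Fin 3))) => 2 / 3 * (Eb N z x / ρb N z x - ‖mb N z x‖ ^ 2 / (2 * ρb N z x ^ 2)); Tendsto (fun N : ℕ => Literature.MathematicalPhysics.KineticTheory.localGibbsLaw σ a₀ u₀ θ₀ N (Φ N) {z | ∃ s ∈ Icc 0 t, ∃ x : (UnitAddTorus (Fin 3)), η₁ < ρb N ((Φ N).flow s z) x * σ ^ 3}) atTop (𝓝 0) → ∀ ψ : ℝ → (UnitAddTorus (Fin 3)) → (EuclideanSpace ℝ (Fin 3)), Literature.Analysis.FunctionSpaces.Torus.IsSmoothSpaceTimeOn (Icc 0 t) ψ → let D := fun (N : ℕ) (z : Literature.Analysis.FluidPDE.Config (N + 1) (Fin 3) (UnitAddTorus (Fin 3))) (x : (UnitAddTorus (Fin 3))) (j k : Fin 3) => (∫ y, φ N (y.1 - x) * ((y.2 j - ub N z x j) * (y.2 k - ub N z x k)) ∂(Literature.Analysis.FluidPDE.empiricalMeasure z)) - (if j = k then (∑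 l : Fin 3, ∫ y, φ N (y.1 - x) * (y.2 l - ub N z x l) ^ 2 ∂(Literature.Analysis.FluidPDE.empiricalMeasure z)) / 3 else 0); let pc := fun (r th : ℝ) => Literature.MathematicalPhysics.KineticTheory.hsPressure σ r th - r * th; let nrm := fun (N : ℕ) (w : Literature.Analysis.FluidPDE.Config (N + 1) (Fin 3) (UnitAddTorus (Fin 3))) (i j : Fin (N + 1)) => (Literature.Analysis.FluidPDE.Torus.geometry (Fin 3)).sepVec (w i).1 (w j).1; let ω := fun (N : ℕ) (w : Literature.Analysis.FluidPDE.Config (N + 1) (Fin 3) (UnitAddTorus (Fin 3))) (i j : Fin (N + 1)) => ‖nrm N w i j‖⁻¹ • nrm N w i j; let M := fun (N : ℕ) (z : Literature.Analysis.FluidPDE.Config (N + 1) (Fin 3) (UnitAddTorus (Fin 3))) (τ : ℝ) => ((N : ℝ) + 1)⁻¹ * (Φ N).collisionPairSum (Ioc 0 τ) (fun (s : ℝ) (w : Literature.Analysis.FluidPDE.Config (N + 1) (Fin 3) (UnitAddTorus (Fin 3))) (i j : Fin (N + 1)) => Literature.MathematicalPhysics.KineticTheory.hsDiameter σ N / 2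 * ‖dv N w i j‖ * ∑ a, ∑ b, ω N w i j a * ω N w i j b * Literature.Analysis.FunctionSpaces.Torus.gradient (fun y => ψ s y a) (w i).1 b) z; let W₁ := fun (N : ℕ) (z : Literature.Analysis.FluidPDE.Config (N + 1) (Fin 3) (UnitAddTorus (Fin 3))) (τ : ℝ) => ∫ s in Icc 0 τ, ∫ x, Literature.Analysis.FunctionSpaces.Torus.divergence (ψ s) x * pc (ρb N ((Φ N).flow s z) x) (θb N ((Φ N).flow s z) x); let W₂ := fun (N : ℕ) (z : Literature.Analysis.FluidPDE.Config (N + 1) (Fin 3) (UnitAddTorus (Fin 3))) (τ : ℝ) => ∫ s in Icc 0 τ, ∫ x, 2 / 5 * (∑ a, ∑ b, D N ((Φ N).flow s z) x a b * Literature.Analysis.FunctionSpaces.Torus.gradient (fun y => ψ s y a) x b) / (ρb N ((Φ N).flow s z) x * θb N ((Φ N).flow s z) x) * pc (ρb N ((Φ N).flow s z) x) (θb N ((Φ N).flow s z) x); ∀ δ : ℝ, 0 < δ → Tendsto (fun N : ℕ => Literature.MathematicalPhysics.KineticTheory.localGibbsLaw σ a₀ u₀ θ₀ N (Φ N) {z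 | ∃ τ ∈ Icc 0 t, δ < |M N z τ - (W₁ N z τ + W₂ N z τ)|}) atTop (𝓝 0)

/-- [Kq] in ROUTE vocabulary: the text of the shared engine item `MesoscaleCollisionalEnergyFluxLaw`. Equivalent to
`CollisionalEnergyFluxLaw` (`collisionalEnergyFluxLaw_iff_inline`). -/
def CollisionalEnergyFluxLawInline : Prop :=
  ∀ (a₀ θ₀ : (UnitAddTorus (Fin 3)) → ℝ) (u₀ : (UnitAddTorus (Fin 3)) → (EuclideanSpace ℝ (Fin 3))), Continuous a₀ → Continuous θ₀ → Continuous u₀ → (∀ x, 0 < a₀ x) → (∀ x, 0 < θ₀ x) → ∃ σ₀ : ℝ, 0 < σ₀ ∧ ∃ η₁ : ℝ, 0 < η₁ ∧ ∀ σ : ℝ, 0 < σ → σ < σ₀ → ∀ Φ : (N : ℕ) → Literature.Analysis.FluidPDE.HardSphereFlow (Literature.Analysis.FluidPDE.Torus.geometry (Fin 3)) (Literature.MathematicalPhysics.KineticTheory.hsDiameter σ N) (N + 1), ∀ t : ℝ, 0 < t → let dv := fun (N : ℕ) (w : Literature.Analysis.FluidPDE.Config (N + 1) (Fin 3) (UnitAddTorus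 (Fin 3))) (i j : Fin (N + 1)) => (w i).2 - (Literature.Analysis.FluidPDE.reflectVel ((Literature.Analysis.FluidPDE.Torus.geometry (Fin 3)).sepVec (w i).1 (w j).1) ((w i).2, (w j).2)).1; let V := fun (N : ℕ) (z : Literature.Analysis.FluidPDE.Config (N + 1) (Fin 3) (UnitAddTorus (Fin 3))) (τ : ℝ) => ((N : ℝ) + 1)⁻¹ * (Φ N).collisionPairSum (Ioc 0 τ) (fun (_ : ℝ) (w : Literature.Analysis.FluidPDE.Config (N + 1) (Fin 3) (UnitAddTorus (Fin 3))) (i j : Fin (N + 1)) => Literature.MathematicalPhysics.KineticTheory.hsDiameter σ N * ‖dv N w i j‖ * (1 + ‖(w i).2‖ + ‖(w j).2‖)) z; (∀ δ : ℝ, 0 < δ → ∃ K : ℝ, ∀ᶠ N : ℕ in atTop, Literature.MathematicalPhysics.KineticTheory.localGibbsLaw σ a₀ u₀ θ₀ N (Φ N) {z | K < V N z t} ≤ ENNReal.ofReal δ) → ∀ (γ C : ℝ) (φ : ℕ → (UnitAddTorus (Fin 3)) → ℝ), 0 < γ → γ ≤ 1 / 15 → ((∀ N, Literature.Analysis.FunctionSpaces.Torus.IsSmooth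 (φ N)) ∧ (∀ N y, 0 ≤ φ N y) ∧ (∀ N, ∫ y, φ N y = 1) ∧ (∀ (N : ℕ) y, ((N : ℝ) + 1) ^ (-γ) ≤ Literature.Analysis.FluidPDE.Torus.euclidDist y 0 → φ N y = 0) ∧ (∀ (N : ℕ) y, φ N y ≤ C * ((N : ℝ) + 1) ^ (3 * γ)) ∧ (∀ (N : ℕ) y, ‖Literature.Analysis.FunctionSpaces.Torus.gradient (φ N) y‖ ≤ C * ((N : ℝ) + 1) ^ (4 * γ))) → let ρb := fun (N : ℕ) (z : Literature.Analysis.FluidPDE.Config (N + 1) (Fin 3) (UnitAddTorus (Fin 3))) (x : (UnitAddTorus (Fin 3))) => Literature.MathematicalPhysics.KineticTheory.empiricalDensityField z (fun y => φ N (y - x)); let mb := fun (N : ℕ) (z : Literature.Analysis.FluidPDE.Config (N + 1) (Fin 3) (UnitAddTorus (Fin 3))) (x : (UnitAddTorus (Fin 3))) => Literature.MathematicalPhysics.KineticTheory.empiricalMomentumField z (fun y => φ N (y - x)); let Eb := fun (N : ℕ) (z : Literature.Analysis.FluidPDE.Config (N + 1) (Fin 3) (UnitAddTorus (Fin 3)))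 (x : (UnitAddTorus (Fin 3))) => Literature.MathematicalPhysics.KineticTheory.empiricalEnergyField z (fun y => φ N (y - x)); let ub := fun (N : ℕ) (z : Literature.Analysis.FluidPDE.Config (N + 1) (Fin 3) (UnitAddTorus (Fin 3))) (x : (UnitAddTorus (Fin 3))) => (ρb N z x)⁻¹ • mb N z x; let θb := fun (N : ℕ) (z : Literature.Analysis.FluidPDE.Config (N + 1) (Fin 3) (UnitAddTorus (Fin 3))) (x : (UnitAddTorus (Fin 3))) => 2 / 3 * (Eb N z x / ρb N z x - ‖mb N z x‖ ^ 2 / (2 * ρb N z x ^ 2)); Tendsto (fun N : ℕ => Literature.MathematicalPhysics.KineticTheory.localGibbsLaw σ a₀ u₀ θ₀ N (Φ N) {z | ∃ s ∈ Icc 0 t, ∃ x : (UnitAddTorus (Fin 3)), η₁ < ρb N ((Φ N).flow s z) x * σ ^ 3}) atTop (𝓝 0) → ∀ χ : ℝ → (UnitAddTorus (Fin 3)) → ℝ, Literature.Analysis.FunctionSpaces.Torus.IsSmoothSpaceTimeOn (Icc 0 t) χ → let D := fun (N : ℕ) (z : Literature.Analysis.FluidPDE.Config (N + 1) (Fin 3)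 (UnitAddTorus (Fin 3))) (x : (UnitAddTorus (Fin 3))) (j k : Fin 3) => (∫ y, φ N (y.1 - x) * ((y.2 j - ub N z x j) * (y.2 k - ub N z x k)) ∂(Literature.Analysis.FluidPDE.empiricalMeasure z)) - (if j = k then (∑ l : Fin 3, ∫ y, φ N (y.1 - x) * (y.2 l - ub N z x l) ^ 2 ∂(Literature.Analysis.FluidPDE.empiricalMeasure z)) / 3 else 0); let q := fun (N : ℕ) (z : Literature.Analysis.FluidPDE.Config (N + 1) (Fin 3) (UnitAddTorus (Fin 3))) (x : (UnitAddTorus (Fin 3))) => ∫ y, (φ N (y.1 - x) * ‖y.2 - ub N z x‖ ^ 2 / 2) • (y.2 - ub N z x) ∂(Literature.Analysis.FluidPDE.empiricalMeasure z); let pc := fun (r th : ℝ) => Literature.MathematicalPhysics.KineticTheory.hsPressure σ r th - r * th; let nrm := fun (N : ℕ) (w : Literature.Analysis.FluidPDE.Config (N + 1) (Fin 3) (UnitAddTorus (Fin 3))) (i j : Fin (N + 1)) => (Literature.Analysis.FluidPDE.Torus.geometry (Fin 3)).sepVec (w i).1 (w j).1; let ω := fun (N : ℕ) (w : Literature.Analysis.FluidPDE.Config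 (N + 1) (Fin 3) (UnitAddTorus (Fin 3))) (i j : Fin (N + 1)) => ‖nrm N w i j‖⁻¹ • nrm N w i j; let M := fun (N : ℕ) (z : Literature.Analysis.FluidPDE.Config (N + 1) (Fin 3) (UnitAddTorus (Fin 3))) (τ : ℝ) => ((N : ℝ) + 1)⁻¹ * (Φ N).collisionPairSum (Ioc 0 τ) (fun (s : ℝ) (w : Literature.Analysis.FluidPDE.Config (N + 1) (Fin 3) (UnitAddTorus (Fin 3))) (i j : Fin (N + 1)) => Literature.MathematicalPhysics.KineticTheory.hsDiameter σ N / 2 * ‖dv N w i j‖ * (inner ℝ ((1 / 2 : ℝ) • ((w i).2 + (w j).2)) (ω N w i j) * ∑ a, ω N w i j a * Literature.Analysis.FunctionSpaces.Torus.gradient (χ s) (w i).1 a)) z; let W₁ := fun (N : ℕ) (z : Literature.Analysis.FluidPDE.Config (N + 1) (Fin 3) (UnitAddTorus (Fin 3))) (τ : ℝ) => ∫ s in Icc 0 τ, ∫ x, (∑ j, Literature.Analysis.FunctionSpaces.Torus.gradient (χ s) x j * ub N ((Φ N).flow s z) x j) * pc (ρb N ((Φ N).flow s z) x) (θb N ((Φ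 N).flow s z) x); let W₂ := fun (N : ℕ) (z : Literature.Analysis.FluidPDE.Config (N + 1) (Fin 3) (UnitAddTorus (Fin 3))) (τ : ℝ) => ∫ s in Icc 0 τ, ∫ x, (2 / 5 * (∑ a, ∑ b, D N ((Φ N).flow s z) x a b * ub N ((Φ N).flow s z) x b * Literature.Analysis.FunctionSpaces.Torus.gradient (χ s) x a) / (ρb N ((Φ N).flow s z) x * θb N ((Φ N).flow s z) x) + 3 / 5 * (∑ a, q N ((Φ N).flow s z) x a * Literature.Analysis.FunctionSpaces.Torus.gradient (χ s) x a) / (ρb N ((Φ N).flow s z) x * θb N ((Φ N).flow s z) x)) * pc (ρb N ((Φ N).flow s z) x) (θb N ((Φ N).flow s z) x); ∀ δ : ℝ, 0 < δ → Tendsto (fun N : ℕ => Literature.MathematicalPhysics.KineticTheory.localGibbsLaw σ a₀ u₀ θ₀ N (Φ N) {z | ∃ τ ∈ Icc 0 t, δ < |M N z τ - (W₁ N z τ + W₂ N z τ)|}) atTop (𝓝 0)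

/-! ## Bookkeeping: `∇0 = 0`, `div 0 = 0`, the line's kernels at a zero test, and the equivalences -/

/-- The torus gradient of a constant scalar vanishes. [folklore] -/
theorem torusGradient_const (c : ℝ) (x : T3) :
    Literature.Analysis.FunctionSpaces.Torus.gradient (fun _ : T3 => c) x = 0 := by
  show _root_.gradient (fun _ : EuclideanSpace ℝ (Fin 3) => c) 0 = 0
  exact gradient_fun_const (0 : EuclideanSpace ℝ (Fin 3)) c

/-- `gradPsi 0 = 0`. -/
theorem gradPsi_zero (s : ℝ) (x : T3) (a b : Fin 3) : gradPsi (fun (_ : ℝ) (_ : T3) => (0 : V3)) s x a b = 0 := by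
  simp only [gradPsi, PiLp.zero_apply, torusGradient_const]

/-- The flux-form mark kernel at `χ ≡ 0` is the stress-mark kernel (as functions of `(s, w, i, j)`). -/
theorem markK_zero_chi (σ : ℝ) (ψ : ℝ → T3 → V3) (N : ℕ) :
    markK σ ψ (fun (_ : ℝ) (_ : T3) => (0 : ℝ)) N = fun (s : ℝ) (w : Cfg N) (i j : Fin (N + 1)) =>
      Literature.MathematicalPhysics.KineticTheory.hsDiameter σ N / 2 * ‖dV N w i j‖ *
        ∑ a, ∑ b, omg N w i j a * omg N w i j b * gradPsi ψ s (w i).1 a b := by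
  funext s w i j
  simp [markK, ChannelAdditivity.gradChi_zero]

/-- The flux-form mark kernel at `ψ ≡ 0` is the energy-mark kernel (as functions of `(s, w, i, j)`). -/
theorem markK_zero_psi (σ : ℝ) (χ : ℝ → T3 → ℝ) (N : ℕ) :
    markK σ (fun (_ : ℝ) (_ : T3) => (0 : V3)) χ N = fun (s : ℝ) (w : Cfg N) (i j : Fin (N + 1)) =>
      Literature.MathematicalPhysics.KineticTheory.hsDiameter σ N / 2 * ‖dV N w i j‖ *
        (⟪Vcm N w i j, omg N w i j⟫_ℝ * ∑ a, omg N w i j a * gradChi χ s (w i).1 a) := by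
  funext s w i j
  simp [markK, gradPsi_zero]

/-- The Euler weight at `χ ≡ 0` is `div ψ`. -/
theorem eulerW_zero_chi (ψ : ℝ → T3 → V3) (φ : ℕ → T3 → ℝ) (N : ℕ) (s : ℝ) (z : Cfg N) (x : T3) :
    eulerW ψ (fun (_ : ℝ) (_ : T3) => (0 : ℝ)) φ N s z x = divPsi ψ s x := by
  simp [eulerW, ChannelAdditivity.gradChi_zero]

/-- The Euler weight at `ψ ≡ 0` is `∇χ·ū`. -/
theorem eulerW_zero_psi (χ : ℝ → T3 → ℝ) (φ : ℕ → T3 → ℝ) (N : ℕ) (s : ℝ) (z : Cfg N) (x : T3) :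
    eulerW (fun (_ : ℝ) (_ : T3) => (0 : V3)) χ φ N s z x = ∑ j, gradChi χ s x j * uB φ N z x j := by
  simp [eulerW, ChannelAdditivity.divPsi_zero]

/-- The kinetic-correction weight at `χ ≡ 0`. -/
theorem kinW_zero_chi (ψ : ℝ → T3 → V3) (φ : ℕ → T3 → ℝ) (N : ℕ) (s : ℝ) (z : Cfg N) (x : T3) :
    kinW ψ (fun (_ : ℝ) (_ : T3) => (0 : ℝ)) φ N s z x =
      2 / 5 * (∑ a, ∑ b, Dst φ N z x a b * gradPsi ψ s x a b) / pkin φ N z x := by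
  simp [kinW, ChannelAdditivity.gradChi_zero]

/-- The kinetic-correction weight at `ψ ≡ 0`. -/
theorem kinW_zero_psi (χ : ℝ → T3 → ℝ) (φ : ℕ → T3 → ℝ) (N : ℕ) (s : ℝ) (z : Cfg N) (x : T3) :
    kinW (fun (_ : ℝ) (_ : T3) => (0 : V3)) χ φ N s z x =
      2 / 5 * (∑ a, ∑ b, Dst φ N z x a b * uB φ N z x b * gradChi χ s x a) / pkin φ N z x +
        3 / 5 * (∑ a, qfl φ N z x a * gradChi χ s x a) / pkin φ N z x := by
  simp [kinW, gradPsi_zero]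


/-- **[Kσ]: the inline (route-vocabulary) text IS the line statement.** -/
theorem collisionalStressLaw_iff_inline : CollisionalStressLawInline ↔ CollisionalStressLaw := by
  constructor
  · intro h a₀ θ₀ u₀ hP
    obtain ⟨σ₀, hσ₀, η₁, hη₁, H⟩ := h a₀ θ₀ u₀ hP.1 hP.2.1 hP.2.2.1 hP.2.2.2.1 hP.2.2.2.2
    refine ⟨σ₀, hσ₀, η₁, hη₁, ?_⟩
    intro σ hσ hlt Φ t ht hV γ C φ hγ hγ' hadm hD ψ hψ δ hδ
    have H' := H σ hσ hlt Φ t ht hV γ C φ hγ hγ' hadm hD ψ hψ δ hδ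
    simpa only [Mfun, Rhs, Kfun, markK_zero_chi, eulerW_zero_chi, kinW_zero_chi, dV, omg, sepV, Vcm, gradPsi, gradChi, divPsi, pcoll, pkin, rhoB, thetaB, EB, mB, uB, Dst, qfl] using H'
  · intro h a₀ θ₀ u₀ ha hθ hu ha0 hθ0
    obtain ⟨σ₀, hσ₀, η₁, hη₁, H⟩ := h a₀ θ₀ u₀ ⟨ha, hθ, hu, ha0, hθ0⟩
    refine ⟨σ₀, hσ₀, η₁, hη₁, ?_⟩
    intro σ hσ hlt Φ t ht dv V hV γ C φ hγ hγ' hadm ρb mb Eb ub θb hD ψ hψ D pc nrm ω M W₁ W₂ δ hδ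
    have H' := H σ hσ hlt Φ t ht hV γ C φ hγ hγ' hadm hD ψ hψ δ hδ
    simpa only [Mfun, Rhs, Kfun, markK_zero_chi, eulerW_zero_chi, kinW_zero_chi, dV, omg, sepV, Vcm, gradPsi, gradChi, divPsi, pcoll, pkin, rhoB, thetaB, EB, mB, uB, Dst, qfl] using H'

/-- **[Kq]: the inline (route-vocabulary) text IS the line statement.** -/
theorem collisionalEnergyFluxLaw_iff_inline : CollisionalEnergyFluxLawInline ↔ CollisionalEnergyFluxLaw := by
  constructor
  · intro h a₀ θ₀ u₀ hP
    obtain ⟨σ₀, hσ₀, η₁, hη₁, H⟩ := h a₀ θ₀ u₀ hP.1 hP.2.1 hP.2.2.1 hP.2.2.2.1 hP.2.2.2.2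
    refine ⟨σ₀, hσ₀, η₁, hη₁, ?_⟩
    intro σ hσ hlt Φ t ht hV γ C φ hγ hγ' hadm hD χ hχ δ hδ
    have H' := H σ hσ hlt Φ t ht hV γ C φ hγ hγ' hadm hD χ hχ δ hδ
    simpa only [Mfun, Rhs, Kfun, markK_zero_psi, eulerW_zero_psi, kinW_zero_psi, dV, omg, sepV, Vcm, gradPsi, gradChi, divPsi, pcoll, pkin, rhoB, thetaB, EB, mB, uB, Dst, qfl] using H'
  · intro h a₀ θ₀ u₀ ha hθ hu ha0 hθ0
    obtain ⟨σ₀, hσ₀, η₁, hη₁, H⟩ := h a₀ θ₀ u₀ ⟨ha, hθ, hu, ha0, hθ0⟩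
    refine ⟨σ₀, hσ₀, η₁, hη₁, ?_⟩
    intro σ hσ hlt Φ t ht dv V hV γ C φ hγ hγ' hadm ρb mb Eb ub θb hD χ hχ D q pc nrm ω M W₁ W₂ δ hδ
    have H' := H σ hσ hlt Φ t ht hV γ C φ hγ hγ' hadm hD χ hχ δ hδ
    simpa only [Mfun, Rhs, Kfun, markK_zero_psi, eulerW_zero_psi, kinW_zero_psi, dV, omg, sepV, Vcm, gradPsi, gradChi, divPsi, pcoll, pkin, rhoB, thetaB, EB, mB, uB, Dst, qfl] using H'

end

end Summit.AtomisticToContinuum.HydrodynamicLimit.Theorems.HemisphereAffineSlaving
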